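import Literature.AnabelianGeometry.EtaleTheta.Discharge.Sec1Thm110iiOfDecompTransport
import HarnessLib

/-!
# [EtTh] Thm. 1.10 (i) «γ preserves standard type» from (ii): the matching of the 4-torsion points
# (K2 rows T110.i.r7 + T110.ii.r5/r6; sequel of `Sec1Thm110iiOfDecompTransport.lean`)

S. Mochizuki, *The étale theta function …*, Publ. RIMS 45 (2009), §1, Thm. 1.10 (i) p.255 («The isomorphism
`γ` preserves the property that `η̈^{Θ,Z}_☐` be of standard type»), with its printed proof «assertion (i)
follows formally from assertion (ii)» p.256 [cite: MochizukiEtTh2009, Thm 1.10 (i) p.29].  PROOF-ONLY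
companion (no `def`) of this seat's `ConstantMultipleRigiditySub.lean` (p417168: `Thm110ValuesBackward`,
`Thm110DeltaCompat`, `thm110i_of_values_of_deltaCompat`) and `Discharge/Sec1Thm110iiOfDecompTransport.lean`
(p428966: `MuTwoSetting.image_valuesAt_eq`, `thm110ValuesForward_of_decompTransport`).  Cell sub-DAG
plan/L2/SUBDAG-EtTh-Thm110.md (K2), holder abc-iut-w5-d140.

* `Thm110Hypothesis.image_valuesAt_etaDd_eq` — at anchored points `yα`, `yβ` with `γ(D_{yα}) = σ D_{yβ} σ⁻¹`
  (`σ` over `Ẋβ`): `δ(η̈^{Θ,Z}_α|_{yα}) = η̈^{Θ,Z}_β|_{yβ}` (the public form of the key step of p428966);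
* `thm110ValuesForward_of_matching`, `thm110ValuesBackward_of_matching` — both halves of row r6 from ONE
  hypothesis, the MATCHING of the 4-torsion points: `γ` carries `(D_{τα}, D_{τα⁻¹})` onto
  `Π^tp_{Ẋβ}`-conjugates of `(D_{τβ}, D_{τβ⁻¹})` or of `(D_{τβ⁻¹}, D_{τβ})` (print: «the decomposition groups of
  the torsion points», labels `±√−1` up to the deck involution);
* **`thm110i_of_matching`** — the typed F-0512 `Thm110i H Aα.toStandardData Aβ.toStandardData` from
  {`Thm110DeltaInduced H δ`, `Thm110DeltaCompat δ` (row r7: `δ` respects `O^×`, `|·|`, `±1` — [AbsAnab]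
  Prop. 1.2.1), the matching, Prop. 1.5 (ii) on both sides}; and `thm110ii_of_matching` likewise.
HONEST FRAMING: typed ≠ proved for [EtTh]; the named inputs are hypotheses BY NAME; nothing here bears on
the disputed [IUTchIII] Cor. 3.12.
-/

noncomputable section

namespace Literature.AnabelianGeometry.EtaleTheta

open Literature.AnabelianGeometry.SemiGraphs

variable {p : ℕ} [Fact p.Prime]

section Thm110

variable {Mα Mβ : MuTwoSetting p} {εα : Mα.GtpC} {εβ : Mβ.GtpC} {hCα : Mα.toThetaSetting.Compat}
  {hCβ : Mβ.toThetaSetting.Compat} {Eα : Mα.toThetaSetting.EtaleThetaData}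
  {Eβ : Mβ.toThetaSetting.EtaleThetaData} {γ : Mα.dotC εα ≃ₜ* Mβ.dotC εβ}

/-- **The standard values at matched anchored points correspond under `δ`**: if `γ(D_{yα}) = σ D_{yβ} σ⁻¹`
with `σ` over `Ẋβ` (both points anchored), then `δ(η̈^{Θ,Z}_α|_{yα}) = η̈^{Θ,Z}_β|_{yβ}`.
[cite: MochizukiEtTh2009, Thm 1.10 (ii) p.30] -/
theorem Thm110Hypothesis.image_valuesAt_etaDd_eq (H : Thm110Hypothesis εα εβ hCα hCβ Eα Eβ γ)
    (h15iiα : ThetaSetting.Prop15ii Eα.toKummerData hCα)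
    (h15iiβ : ThetaSetting.Prop15ii Eβ.toKummerData hCβ)
    (δ : (↥Mα.Kdd)ˣ ≃* (↥Mβ.Kdd)ˣ) (hδ : Thm110DeltaInduced H δ)
    (yα : ThetaSetting.AnchoredPoint Eα.toKummerData) (yβ : ThetaSetting.AnchoredPoint Eβ.toKummerData)
    {σ : Mβ.PiTemp} (hσ : Mβ.inclX σ ∈ Mβ.dotX εβ)
    (hD : yα.Dpt.map H.γX.toMulEquiv.toMonoidHom = yβ.Dpt.map (MulAut.conj σ).toMonoidHom) :
    δ '' Mα.valuesAt hCα εα Eα.etaDd yα.toNonCuspidalPoint =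
      Mβ.valuesAt hCβ εβ Eβ.etaDd yβ.toNonCuspidalPoint := by
  rw [MuTwoSetting.image_valuesAt_eq hCα hCβ h15iiα h15iiβ H.companion H.thm16i δ hδ
    H.inclX_mem_dotX_iff yα yβ hσ hD, H.valuesAt_transport_etaDd]

/-- The inverse image form: `δ⁻¹(η̈^{Θ,Z}_β|_{yβ}) = η̈^{Θ,Z}_α|_{yα}`. [cite: MochizukiEtTh2009, Thm 1.10 (ii) p.30] -/
theorem Thm110Hypothesis.symm_image_valuesAt_etaDd_eq (H : Thm110Hypothesis εα εβ hCα hCβ Eα Eβ γ)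
    (h15iiα : ThetaSetting.Prop15ii Eα.toKummerData hCα)
    (h15iiβ : ThetaSetting.Prop15ii Eβ.toKummerData hCβ)
    (δ : (↥Mα.Kdd)ˣ ≃* (↥Mβ.Kdd)ˣ) (hδ : Thm110DeltaInduced H δ)
    (yα : ThetaSetting.AnchoredPoint Eα.toKummerData) (yβ : ThetaSetting.AnchoredPoint Eβ.toKummerData)
    {σ : Mβ.PiTemp} (hσ : Mβ.inclX σ ∈ Mβ.dotX εβ)
    (hD : yα.Dpt.map H.γX.toMulEquiv.toMonoidHom = yβ.Dpt.map (MulAut.conj σ).toMonoidHom) :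
    δ.symm '' Mβ.valuesAt hCβ εβ Eβ.etaDd yβ.toNonCuspidalPoint =
      Mα.valuesAt hCα εα Eα.etaDd yα.toNonCuspidalPoint := by
  rw [← H.image_valuesAt_etaDd_eq h15iiα h15iiβ δ hδ yα yβ hσ hD, Set.image_image]
  simp

/-- **Row r6, forward half, from the MATCHING of the 4-torsion points.** [cite: MochizukiEtTh2009, Thm 1.10 (ii) p.30] -/
theorem thm110ValuesForward_of_matching (H : Thm110Hypothesis εα εβ hCα hCβ Eα Eβ γ)
    (Aα : Mα.AnchoredStandardData Eα.toKummerData) (Aβ : Mβ.AnchoredStandardData Eβ.toKummerData)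
    (h15iiα : ThetaSetting.Prop15ii Eα.toKummerData hCα)
    (h15iiβ : ThetaSetting.Prop15ii Eβ.toKummerData hCβ)
    (δ : (↥Mα.Kdd)ˣ ≃* (↥Mβ.Kdd)ˣ) (hδ : Thm110DeltaInduced H δ)
    (hmatch : ∃ σ σ' : Mβ.PiTemp, Mβ.inclX σ ∈ Mβ.dotX εβ ∧ Mβ.inclX σ' ∈ Mβ.dotX εβ ∧
      ((Aα.tau.Dpt.map H.γX.toMulEquiv.toMonoidHom = Aβ.tau.Dpt.map (MulAut.conj σ).toMonoidHom ∧
        Aα.tauInv.Dpt.map H.γX.toMulEquiv.toMonoidHom =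
          Aβ.tauInv.Dpt.map (MulAut.conj σ').toMonoidHom) ∨
       (Aα.tau.Dpt.map H.γX.toMulEquiv.toMonoidHom = Aβ.tauInv.Dpt.map (MulAut.conj σ).toMonoidHom ∧
        Aα.tauInv.Dpt.map H.γX.toMulEquiv.toMonoidHom =
          Aβ.tau.Dpt.map (MulAut.conj σ').toMonoidHom))) :
    Thm110ValuesForward H Aα.toStandardData Aβ.toStandardData δ := by
  refine ⟨hδ, fun V hV => ?_⟩
  obtain ⟨σ, σ', hσ, hσ', ⟨h1, h2⟩ | ⟨h1, h2⟩⟩ := hmatch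
  · rcases hV with rfl | rfl
    · exact Or.inl (H.image_valuesAt_etaDd_eq h15iiα h15iiβ δ hδ Aα.tau Aβ.tau hσ h1)
    · exact Or.inr (H.image_valuesAt_etaDd_eq h15iiα h15iiβ δ hδ Aα.tauInv Aβ.tauInv hσ' h2)
  · rcases hV with rfl | rfl
    · exact Or.inr (H.image_valuesAt_etaDd_eq h15iiα h15iiβ δ hδ Aα.tau Aβ.tauInv hσ h1)
    · exact Or.inl (H.image_valuesAt_etaDd_eq h15iiα h15iiβ δ hδ Aα.tauInv Aβ.tau hσ' h2)

/-- **Row r6, backward half, from the matching** (every standard set of values of `β` is the `δ`-image of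
one of `α`). [cite: MochizukiEtTh2009, Thm 1.10 (ii) p.30] -/
theorem thm110ValuesBackward_of_matching (H : Thm110Hypothesis εα εβ hCα hCβ Eα Eβ γ)
    (Aα : Mα.AnchoredStandardData Eα.toKummerData) (Aβ : Mβ.AnchoredStandardData Eβ.toKummerData)
    (h15iiα : ThetaSetting.Prop15ii Eα.toKummerData hCα)
    (h15iiβ : ThetaSetting.Prop15ii Eβ.toKummerData hCβ)
    (δ : (↥Mα.Kdd)ˣ ≃* (↥Mβ.Kdd)ˣ) (hδ : Thm110DeltaInduced H δ)
    (hmatch : ∃ σ σ' : Mβ.PiTemp, Mβ.inclX σ ∈ Mβ.dotX εβ ∧ Mβ.inclX σ' ∈ Mβ.dotX εβ ∧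
      ((Aα.tau.Dpt.map H.γX.toMulEquiv.toMonoidHom = Aβ.tau.Dpt.map (MulAut.conj σ).toMonoidHom ∧
        Aα.tauInv.Dpt.map H.γX.toMulEquiv.toMonoidHom =
          Aβ.tauInv.Dpt.map (MulAut.conj σ').toMonoidHom) ∨
       (Aα.tau.Dpt.map H.γX.toMulEquiv.toMonoidHom = Aβ.tauInv.Dpt.map (MulAut.conj σ).toMonoidHom ∧
        Aα.tauInv.Dpt.map H.γX.toMulEquiv.toMonoidHom =
          Aβ.tau.Dpt.map (MulAut.conj σ').toMonoidHom))) :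
    Thm110ValuesBackward H Aα.toStandardData Aβ.toStandardData δ := by
  refine ⟨hδ, fun W hW => ?_⟩
  obtain ⟨σ, σ', hσ, hσ', ⟨h1, h2⟩ | ⟨h1, h2⟩⟩ := hmatch
  · rcases hW with rfl | rfl
    · exact Or.inl (H.symm_image_valuesAt_etaDd_eq h15iiα h15iiβ δ hδ Aα.tau Aβ.tau hσ h1)
    · exact Or.inr (H.symm_image_valuesAt_etaDd_eq h15iiα h15iiβ δ hδ Aα.tauInv Aβ.tauInv hσ' h2)
  · rcases hW with rfl | rfl
    · exact Or.inr (H.symm_image_valuesAt_etaDd_eq h15iiα h15iiβ δ hδ Aα.tauInv Aβ.tau hσ' h2)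
    · exact Or.inl (H.symm_image_valuesAt_etaDd_eq h15iiα h15iiβ δ hδ Aα.tau Aβ.tauInv hσ h1)

/-- **[EtTh] Thm. 1.10 (i) — the typed F-0512 `Thm110i` («γ preserves standard type») — at anchored standard
data, from the transport of constants (`Thm110DeltaInduced H δ`), its compatibility with `O^×`, `|·|`, `±1`
(`Thm110DeltaCompat δ`, row r7), the matching of the 4-torsion points under `γ`, and Prop. 1.5 (ii) on both
sides** — «assertion (i) follows formally from assertion (ii)» with (ii) itself derived.
[cite: MochizukiEtTh2009, Thm 1.10 (i) p.29] -/
theorem thm110i_of_matching (H : Thm110Hypothesis εα εβ hCα hCβ Eα Eβ γ)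
    (Aα : Mα.AnchoredStandardData Eα.toKummerData) (Aβ : Mβ.AnchoredStandardData Eβ.toKummerData)
    (h15iiα : ThetaSetting.Prop15ii Eα.toKummerData hCα)
    (h15iiβ : ThetaSetting.Prop15ii Eβ.toKummerData hCβ)
    (δ : (↥Mα.Kdd)ˣ ≃* (↥Mβ.Kdd)ˣ) (hδ : Thm110DeltaInduced H δ)
    (hcompat : Thm110DeltaCompat (Mα := Mα) (Mβ := Mβ) δ)
    (hmatch : ∃ σ σ' : Mβ.PiTemp, Mβ.inclX σ ∈ Mβ.dotX εβ ∧ Mβ.inclX σ' ∈ Mβ.dotX εβ ∧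
      ((Aα.tau.Dpt.map H.γX.toMulEquiv.toMonoidHom = Aβ.tau.Dpt.map (MulAut.conj σ).toMonoidHom ∧
        Aα.tauInv.Dpt.map H.γX.toMulEquiv.toMonoidHom =
          Aβ.tauInv.Dpt.map (MulAut.conj σ').toMonoidHom) ∨
       (Aα.tau.Dpt.map H.γX.toMulEquiv.toMonoidHom = Aβ.tauInv.Dpt.map (MulAut.conj σ).toMonoidHom ∧
        Aα.tauInv.Dpt.map H.γX.toMulEquiv.toMonoidHom =
          Aβ.tau.Dpt.map (MulAut.conj σ').toMonoidHom))) :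
    Thm110i H Aα.toStandardData Aβ.toStandardData :=
  thm110i_of_values_of_deltaCompat
    (thm110ValuesForward_of_matching H Aα Aβ h15iiα h15iiβ δ hδ hmatch)
    (thm110ValuesBackward_of_matching H Aα Aβ h15iiα h15iiβ δ hδ hmatch) hcompat

/-- **Thm. 1.10 (ii) from the matching** (the form of p428966 with one hypothesis for both points).
[cite: MochizukiEtTh2009, Thm 1.10 (ii) p.30] -/
theorem thm110ii_of_matching (H : Thm110Hypothesis εα εβ hCα hCβ Eα Eβ γ)
    (Aα : Mα.AnchoredStandardData Eα.toKummerData) (Aβ : Mβ.AnchoredStandardData Eβ.toKummerData)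
    (h15iiα : ThetaSetting.Prop15ii Eα.toKummerData hCα)
    (h15iiβ : ThetaSetting.Prop15ii Eβ.toKummerData hCβ)
    (δ : (↥Mα.Kdd)ˣ ≃* (↥Mβ.Kdd)ˣ) (hδ : Thm110DeltaInduced H δ)
    (hmatch : ∃ σ σ' : Mβ.PiTemp, Mβ.inclX σ ∈ Mβ.dotX εβ ∧ Mβ.inclX σ' ∈ Mβ.dotX εβ ∧
      ((Aα.tau.Dpt.map H.γX.toMulEquiv.toMonoidHom = Aβ.tau.Dpt.map (MulAut.conj σ).toMonoidHom ∧
        Aα.tauInv.Dpt.map H.γX.toMulEquiv.toMonoidHom =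
          Aβ.tauInv.Dpt.map (MulAut.conj σ').toMonoidHom) ∨
       (Aα.tau.Dpt.map H.γX.toMulEquiv.toMonoidHom = Aβ.tauInv.Dpt.map (MulAut.conj σ).toMonoidHom ∧
        Aα.tauInv.Dpt.map H.γX.toMulEquiv.toMonoidHom =
          Aβ.tau.Dpt.map (MulAut.conj σ').toMonoidHom))) :
    Thm110ii H Aα.toStandardData Aβ.toStandardData :=
  thm110ii_of_valuesForward (thm110ValuesForward_of_matching H Aα Aβ h15iiα h15iiβ δ hδ hmatch)

end Thm110

end Literature.AnabelianGeometry.EtaleTheta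

end
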